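import Literature.AlgebraicGeometry.Motives.TrivialLocusFieldDescent
import HarnessLib

/-!
# `h⁰` is invariant under extension of the base field: `h⁰(P_{L₁}, F_{L₁}) = h⁰(P_{L₀}, F)`
# (cohomology and flat base change in degree `0`; Görtz–Wedhorn II, Cor. 22.91, (23.28.5))

`Motives/TrivialLocusFieldDescent` proves that TRIVIALITY of a divisor class on
`P_{L₀} = P ×_K Spec L₀` (`P → Spec K` proper and geometrically integral) descends along every field
extension `L₀ → L₁` over `K`, through the Čech description `Γ(P_L, 𝒪(F_L)) ≅ Ker(d⁰ ⊗ L)` at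
field-valued points (`cechComplex_h0_fieldPoint`, Görtz–Wedhorn II (23.28.5), PROVED in
`Motives/GrothendieckComplexFieldPointsCechProofs`) and injectivity of `Ker(d⁰ ⊗ L₀) ⊗ L₁ → …`.
This file proves the EQUALITY of dimensions in the same setting:

* `finrank_ker_baseChange_eq_of_field` — `dim_{L₁} Ker(f ⊗_{L₀} L₁) = dim_{L₀} Ker f` for a
  linear map of `L₀`-vector spaces (`L₁` is flat over `L₀`: Mathlib `Module.Flat.lTensor_exact`,
  `lTensor_preserves_injective_linearMap`, `Module.finrank_baseChange`);
* `finrank_ker_baseChange_eq_of_isScalarTower_field` — the same for `d ⊗_A L₁` versus `d ⊗_A L₀`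
  along a tower `A → L₀ → L₁` (Mathlib `cancelBaseChange`);
* **`CartierDivisor.h0_classPullback_whiskerLeft_fieldExt_eq`** —
  **`h⁰(P_{L₁}, F_{L₁}) = h⁰(P_{L₀}, F)`** for the class pullback `F_{L₁}` of `F` along
  `P × m : P_{L₁} → P_{L₀}` (`m : Spec L₁ → Spec L₀` over `K`): Görtz–Wedhorn II, Cor. 22.91
  ("cohomology and flat base change", here `H⁰(P_{L₁}, 𝓛_{L₁}) = H⁰(P_{L₀}, 𝓛) ⊗_{L₀} L₁`);
  Hartshorne III Prop. 9.3.

Everything is proved; no named facts (D-0026). Used for the genus / `h⁰` of curves under extension of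
the ground field and for reading `h⁰` at rational points of a parameter scheme (construction of the
Jacobian, `nonempty_jacobian_of_isSmoothProjective`).

## References

* U. Görtz, T. Wedhorn, *Algebraic Geometry II: Cohomology of Schemes*, Springer Spektrum (2023),
  Cor. 22.91 (p. 388), (23.28.5) (p. 482). [GortzWedhorn2023]
* R. Hartshorne, *Algebraic Geometry*, GTM 52 (1977), III Prop. 9.3. [Hartshorne1977]
-/

universe u

open CategoryTheory CategoryTheory.Limits AlgebraicGeometry MonoidalCategory CartesianMonoidalCategory
  TensorProduct

noncomputable section

namespace Literature.AlgebraicGeometry.Motives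

/-! ### Algebra: kernels under flat base change of fields -/

/-- **`dim_{L₁} Ker(f ⊗_{L₀} L₁) = dim_{L₀} Ker f`** for a linear map `f` of `L₀`-vector spaces and
a field extension `L₀ → L₁`: `L₁` is flat over `L₀`, so `Ker(f ⊗ L₁) = (Ker f) ⊗_{L₀} L₁`
(Mathlib `Module.Flat.lTensor_exact`), of `L₁`-dimension `dim_{L₀} Ker f` (`Module.finrank_baseChange`).
[folklore] -/
theorem finrank_ker_baseChange_eq_of_field {L₀ L₁ : Type*} [Field L₀] [Field L₁] [Algebra L₀ L₁]
    {X Y : Type*} [AddCommGroup X] [Module L₀ X] [AddCommGroup Y] [Module L₀ Y] (f : X →ₗ[L₀] Y) :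
    Module.finrank L₁ (LinearMap.ker (f.baseChange L₁)) = Module.finrank L₀ (LinearMap.ker f) := by
  haveI : Module.Flat L₀ L₁ := Module.Flat.of_free
  have hex : Function.Exact (LinearMap.ker f).subtype f := LinearMap.exact_subtype_ker_map f
  have hex' : Function.Exact ((LinearMap.ker f).subtype.lTensor L₁) (f.lTensor L₁) :=
    Module.Flat.lTensor_exact L₁ hex
  have hinj : Function.Injective ((LinearMap.ker f).subtype.baseChange L₁) :=
    Module.Flat.lTensor_preserves_injective_linearMap (M := L₁) (LinearMap.ker f).subtype
      Subtype.val_injective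
  have hrange : LinearMap.range ((LinearMap.ker f).subtype.baseChange L₁) =
      (LinearMap.ker (f.baseChange L₁)).restrictScalars L₁ := by
    apply le_antisymm
    · rintro _ ⟨x, rfl⟩
      exact hex'.apply_apply_eq_zero x
    · intro y hy
      have hy' : y ∈ LinearMap.ker (f.lTensor L₁) := hy
      rw [hex'.linearMap_ker_eq] at hy'
      obtain ⟨x, rfl⟩ := hy'
      exact ⟨x, rfl⟩
  have e2 : (L₁ ⊗[L₀] LinearMap.ker f) ≃ₗ[L₁] LinearMap.ker (f.baseChange L₁) :=
    (LinearEquiv.ofInjective _ hinj).trans (LinearEquiv.ofEq _ _ hrange)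
  rw [← e2.finrank_eq, Module.finrank_baseChange]

/-- **`dim_{L₁} Ker(d ⊗_A L₁) = dim_{L₀} Ker(d ⊗_A L₀)`** for a tower `A → L₀ → L₁` of a ring and
two fields: `d ⊗_A L₁ = (d ⊗_A L₀) ⊗_{L₀} L₁` (Mathlib `cancelBaseChange`) and
`finrank_ker_baseChange_eq_of_field`. [folklore] -/
theorem finrank_ker_baseChange_eq_of_isScalarTower_field {A L₀ L₁ : Type*} [CommRing A] [Field L₀]
    [Field L₁] [Algebra A L₀] [Algebra A L₁] [Algebra L₀ L₁] [IsScalarTower A L₀ L₁]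
    {M N : Type*} [AddCommGroup M] [Module A M] [AddCommGroup N] [Module A N] (d : M →ₗ[A] N) :
    Module.finrank L₁ (LinearMap.ker (d.baseChange L₁)) =
      Module.finrank L₀ (LinearMap.ker (d.baseChange L₀)) := by
  set f := d.baseChange L₀ with hf
  -- `Ker(d ⊗_A L₁) ≃ Ker((d ⊗_A L₀) ⊗_{L₀} L₁)` through `cancelBaseChange`
  set cM := TensorProduct.AlgebraTensorModule.cancelBaseChange A L₀ L₁ L₁ M with hcM
  set cN := TensorProduct.AlgebraTensorModule.cancelBaseChange A L₀ L₁ L₁ N with hcN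
  have hsq : ∀ x, d.baseChange L₁ (cM x) = cN ((f.baseChange L₁) x) := fun x ↦
    LinearMap.congr_fun (TensorProduct.AlgebraTensorModule.lTensor_comp_cancelBaseChange
      (R := A) (A := L₀) (B := L₁) (M := L₁) (N := M) (Q := N) d) x
  have e1 : LinearMap.ker (f.baseChange L₁) ≃ₗ[L₁] LinearMap.ker (d.baseChange L₁) := by
    refine LinearEquiv.ofBijective
      ((cM.toLinearMap.comp (LinearMap.ker (f.baseChange L₁)).subtype).codRestrict _ fun x ↦ ?_)
      ⟨fun x y hxy ↦ ?_, fun y ↦ ?_⟩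
    · rw [LinearMap.mem_ker, LinearMap.comp_apply, LinearEquiv.coe_coe, hsq]
      change cN ((f.baseChange L₁) x.1) = 0
      rw [LinearMap.mem_ker.1 x.2, map_zero]
    · apply Subtype.ext
      have := congrArg Subtype.val hxy
      exact cM.injective this
    · refine ⟨⟨cM.symm y.1, ?_⟩, ?_⟩
      · rw [LinearMap.mem_ker]
        apply cN.injective
        rw [← hsq, LinearEquiv.apply_symm_apply, LinearMap.mem_ker.1 y.2, map_zero]
      · apply Subtype.ext
        simp
  rw [← e1.finrank_eq]
  exact finrank_ker_baseChange_eq_of_field (L₁ := L₁) f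

/-! ### `h⁰` under extension of the field-valued point -/

namespace CartierDivisor

variable {K : Type u} [Field K] (P : SchemeOver K) [IsProper P.hom] [GeometricallyIntegral P.hom]
  {L₀ L₁ : Type u} [Field L₀] [Field L₁] {π₀ : Spec (.of L₀) ⟶ Spec (.of K)}
  {π₁ : Spec (.of L₁) ⟶ Spec (.of K)} (m : Over.mk π₁ ⟶ Over.mk π₀)

/-- **`h⁰` is invariant under extension of the base field** (cohomology and flat base change in
degree `0`, Görtz–Wedhorn II, Cor. 22.91; Hartshorne III Prop. 9.3): for `P → Spec K` proper and
geometrically integral, fields `L₀ → L₁` over `K` (a `K`-morphism `m : Spec L₁ → Spec L₀`) and a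
Cartier divisor `F` on `P_{L₀} = P ×_K Spec L₀`, the class pullback `F_{L₁}` of `F` along
`P × m : P_{L₁} → P_{L₀}` has `h⁰(P_{L₁}, F_{L₁}) = h⁰(P_{L₀}, F)`: both are the kernels of the Čech
differential `d⁰` base-changed to `L₁`, resp. `L₀` (`cechComplex_h0_fieldPoint`, Görtz–Wedhorn II
(23.28.5), at the field points `m` and `id` of `Spec L₀`), and
`dim_{L₁} Ker(d⁰ ⊗ L₁) = dim_{L₀} Ker(d⁰ ⊗ L₀)` (`finrank_ker_baseChange_eq_of_isScalarTower_field`).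
[cite: GortzWedhorn2023, Cor. 22.91 (p. 388) and (23.28.5) (p. 482)] -/
theorem h0_classPullback_whiskerLeft_fieldExt_eq (F : CartierDivisor (P ⊗ Over.mk π₀).left) :
    letI := fibreOverField P π₀
    letI := fibreOverField P π₁
    (F.classPullback (P ◁ m).left).h0 L₁ = F.h0 L₀ := by
  haveI : IsIntegral (Over.mk π₀).left := inferInstanceAs (IsIntegral (Spec (.of L₀)))
  have hV : IsAffineOpen (⊤ : (Over.mk π₀).left.Opens) := isAffineOpen_top (Spec (.of L₀))
  haveI := quasiCompact_snd_left P (Over.mk π₀)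
  obtain ⟨𝔚⟩ := CartierDivisor.CechCover.nonempty (snd P (Over.mk π₀)).left ⊤ F hV trivial
  have h0 : (𝟙 (Over.mk π₀) : Over.mk π₀ ⟶ Over.mk π₀).left (IsLocalRing.closedPoint L₀) ∈
      (⊤ : (Over.mk π₀).left.Opens) := trivial
  have h1 : m.left (IsLocalRing.closedPoint L₁) ∈ (⊤ : (Over.mk π₀).left.Opens) := trivial
  letI i₀ := fibreOverField P π₀
  letI i₁ := fibreOverField P π₁
  letI a₀ : Algebra Γ((Over.mk π₀).left, (⊤ : (Over.mk π₀).left.Opens)) L₀ :=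
    (evalAtFieldPoint (𝟙 (Over.mk π₀) : Over.mk π₀ ⟶ Over.mk π₀).left ⊤ h0).toAlgebra
  letI a₁ : Algebra Γ((Over.mk π₀).left, (⊤ : (Over.mk π₀).left.Opens)) L₁ :=
    (evalAtFieldPoint m.left ⊤ h1).toAlgebra
  obtain ⟨e₀⟩ := cechComplex_h0_fieldPoint_holds K P (Over.mk π₀) F ⊤ hV 𝔚 L₀ π₀ (𝟙 _) h0
  obtain ⟨e₁⟩ := cechComplex_h0_fieldPoint_holds K P (Over.mk π₀) F ⊤ hV 𝔚 L₁ π₁ m h1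
  -- the tower `Γ(Spec L₀, 𝒪) → L₀ → L₁`
  letI : Algebra L₀ L₁ := (Spec.preimage m.left).hom.toAlgebra
  haveI : IsScalarTower Γ((Over.mk π₀).left, (⊤ : (Over.mk π₀).left.Opens)) L₀ L₁ := by
    refine IsScalarTower.of_algebraMap_eq fun a => ?_
    have eq1 := DFunLike.congr_fun (evalAtFieldPoint_congr (S := Spec (.of L₀))
      (Spec.map_preimage m.left).symm ⊤ h1 trivial) a
    have eq2 := evalAtFieldPoint_SpecMap_top (Spec.preimage m.left) trivial a
    have eq3 := evalAtFieldPoint_id_top h0 a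
    exact eq1.trans (eq2.trans (congrArg (Spec.preimage m.left).hom eq3.symm))
  -- `h⁰` upstairs and downstairs as kernel dimensions
  have hup : (F.classPullback (P ◁ m).left).h0 L₁ =
      Module.finrank L₁ (LinearMap.ker ((𝔚.complex.d 0 1).hom.baseChange L₁)) := e₁.finrank_eq
  have hid : (F.classPullback (P ◁ 𝟙 (Over.mk π₀)).left).LinEquiv F := by
    rw [classPullback_congr (show (P ◁ 𝟙 (Over.mk π₀)).left = 𝟙 _ by
      rw [MonoidalCategory.whiskerLeft_id]; rfl)]
    exact F.classPullback_id_linEquiv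
  have hdown : F.h0 L₀ = Module.finrank L₀ (LinearMap.ker ((𝔚.complex.d 0 1).hom.baseChange L₀)) :=
    (hid.h0_eq (K := L₀)).symm.trans e₀.finrank_eq
  rw [hup, hdown]
  exact finrank_ker_baseChange_eq_of_isScalarTower_field _

end CartierDivisor

end Literature.AlgebraicGeometry.Motives
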